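import Mathlib
import HarnessLib
import Summits.CriticalPhenomena.SAWScalingLimit.Theorems.SAWPhaseRetrievalRetrievalSynthesisRCoset
import Literature.Probability.RandomPlanarGeometry.HexDomainSingleton
import Summits.CriticalPhenomena.SAWScalingLimit.Theorems.SAWPhaseRetrievalRetrievalSynthesisRTools
import Literature.Analysis.Complex.WeylLemmaDbar

/-!
# Lattice Riemann sums, part 2: honeycomb mid-edge Riemann sums
(helper for `RetrievalSynthesisR`, stmt-CriticalPhenomena-14011, route `SAWPhaseRetrieval`)

* the mid-edges of the hexagonal lattice `ℍ` (faces of `𝕋`, embedded by `hexCenter`) are the three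
  cosets `ℤ² + {1/2, ζ/2, (1+ζ)/2}` of the triangular lattice: every edge joins the up face of a
  cell `x` to the down face of `x`, `x - e₀` or `x - e₁` (`hexGraph_adj_iff_of_snd_eq_zero`);
* `tendsto_edge_sum` — for `g` continuous with compact support, `δ² Σ_{e} g(δ · mid e) → 2√3 ∫ g`
  as `δ → 0⁺` (mid-edge density `2√3` per unit area: three cosets of covolume `√3/2`);
* `tendsto_domain_sum` — the same over the mid-edges `hexDomainMidEdges (Λ δ)` of discrete domains
  exhausting the compacts of an open set `U ⊇ tsupport g`;
* consequences for the regions `{e ∈ Ω_δ | δ · mid e ∈ K}`: `finite_hexDomainMidEdges`,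
  `finsum_mem_eq_filter_sum` (the route's `finsum`s are `Finset` sums), `eventually_count_le`
  (`δ² · #{e ∈ Ω_δ | δ·mid e ∈ K}` eventually bounded for compact `K ⊆ U`), `eventually_le_count`
  (bounded below by a positive constant for a closed ball `B ⊆ U`), and the closing real inequality
  `final_bound` of the synthesis.
-/

noncomputable section

namespace Summit.CriticalPhenomena.SAWScalingLimit.Theorems.RetrievalSynthesisR

open scoped BigOperators Topology
open Filter Set Metric MeasureTheory Complex
open Literature.Probability.LatticeModels Literature.Probability.RandomPlanarGeometry.SAW

/-! ### Lattice geometry -/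

/-- A mid-edge is within `1/2` of each endpoint of its edge (the edge length is `1/√3 ≤ 1`). -/
theorem norm_hexCenter_sub_hexMidpoint_le {v w : HexVertex} (h : hexGraph.Adj v w) :
    ‖hexCenter v - hexMidpoint s(v, w)‖ ≤ 1 / 2 := by
  -- adjacent faces have centres at squared distance `1/3`
  -- (adapted from `Cruxes/DefectDecoherence/WallExitTwoPoint.lean`, `normSq_hexCenter_sub_of_adj`)
  have hsq : Complex.normSq (hexCenter w - hexCenter v) = 1 / 3 := by
    obtain ⟨x, i⟩ := w
    obtain ⟨y, j⟩ := v
    rw [hexCenter_sub_hexCenter, normSq_add_mul_triZeta]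
    fin_cases i <;> fin_cases j
    · exact absurd h (not_hexGraph_adj_of_snd_eq_holds _ _ rfl)
    · rcases (hexGraph_adj_iff_of_snd_eq_zero_holds x y).1 h.symm with rfl | rfl | rfl
      · simp; norm_num
      · simp [Pi.sub_apply]; norm_num
      · simp [Pi.sub_apply]; norm_num
    · rcases (hexGraph_adj_iff_of_snd_eq_zero_holds y x).1 h with rfl | rfl | rfl
      · simp; norm_num
      · simp [Pi.sub_apply]; norm_num
      · simp [Pi.sub_apply]; norm_num
    · exact absurd h (not_hexGraph_adj_of_snd_eq_holds _ _ rfl)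
  have e : hexCenter v - hexMidpoint s(v, w) = -((hexCenter w - hexCenter v) / 2) := by
    rw [hexMidpoint_mk]; ring
  rw [e, norm_neg, norm_div, Complex.norm_two]
  have h1 : ‖hexCenter w - hexCenter v‖ ≤ 1 := by
    rw [← sq_le_one_iff₀ (norm_nonneg _), Complex.sq_norm, hsq]
    norm_num
  linarith

/-- `3 · (Im ζ)⁻¹ = 2√3`. -/
theorem three_mul_inv_triZeta_im : (3 : ℝ) * (triZeta.im)⁻¹ = 2 * Real.sqrt 3 := by
  rw [triZeta_im]
  have h3 : Real.sqrt 3 * Real.sqrt 3 = 3 := Real.mul_self_sqrt (by norm_num)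
  have h0 : 0 < Real.sqrt 3 := Real.sqrt_pos.2 (by norm_num)
  field_simp
  linarith

/-! ### Riemann sums over the mid-edges -/

/-- **Riemann sums over all mid-edges of `ℍ`.** For `g` continuous with compact support,
`δ² Σ_{e} g(δ · mid e) → 2√3 ∫ g` as `δ → 0⁺`. The edges are parametrised by
`(j, x) ↦ {(x, up), (x - d_j, down)}` with `d = (0, e₀, e₁)`, whose midpoints form the cosets
`ℤ² + (1 + ζ - triEmbed d_j)/2`. -/
theorem tendsto_edge_sum {g : ℂ → ℂ} (hg : Continuous g) (hgs : HasCompactSupport g) :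
    Tendsto (fun δ : ℝ => (δ : ℂ) ^ 2 * ∑ᶠ e ∈ hexGraph.edgeSet, g ((δ : ℂ) * hexMidpoint e))
      (𝓝[>] 0) (𝓝 ((2 * Real.sqrt 3 : ℝ) * ∫ z, g z)) := by
  have hS : IsCompact (tsupport g) := hgs
  -- the three edge classes
  set dvec : Fin 3 → Site 2 := ![0, Pi.single 0 1, Pi.single 1 1] with hdvec
  set edgeOf : Fin 3 × Site 2 → Sym2 HexVertex :=
    fun q => s((q.2, (0 : Fin 2)), (q.2 - dvec q.1, (1 : Fin 2))) with hedgeOf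
  set toff : Fin 3 → ℂ := fun j => (1 + triZeta - triEmbed (dvec j)) / 2 with htoff
  have hmid : ∀ q, hexMidpoint (edgeOf q) = triEmbed q.2 + toff q.1 := by
    intro q
    simp only [hedgeOf, htoff, hexMidpoint_mk, hexCenter, triEmbed_sub, Fin.val_zero, Fin.val_one,
      Nat.cast_zero, Nat.cast_one]
    ring
  have hadj : ∀ q : Fin 3 × Site 2, hexGraph.Adj (q.2, 0) (q.2 - dvec q.1, 1) := by
    rintro ⟨j, x⟩
    rw [hexGraph_adj_iff_of_snd_eq_zero_holds]
    fin_cases j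
    · left; simp [hdvec]
    · right; left; simp [hdvec]
    · right; right; simp [hdvec]
  have hdinj : Function.Injective dvec := by
    intro i j h
    have h0 := congrFun h 0
    have h1 := congrFun h 1
    revert h0 h1
    fin_cases i <;> fin_cases j <;> simp [hdvec]
  have hinj : Function.Injective edgeOf := by
    rintro ⟨j, x⟩ ⟨j', x'⟩ h
    simp only [hedgeOf] at h
    rw [Sym2.eq_iff] at h
    rcases h with ⟨h1, h2⟩ | ⟨h1, -⟩
    · rw [Prod.mk.injEq] at h1 h2
      obtain ⟨rfl, -⟩ := h1
      have : dvec j = dvec j' := sub_right_inj.1 h2.1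
      rw [hdinj this]
    · rw [Prod.mk.injEq] at h1
      exact absurd h1.2 (by decide)
  have hrange : Set.range edgeOf = hexGraph.edgeSet := by
    apply Set.Subset.antisymm
    · rintro _ ⟨q, rfl⟩; exact (SimpleGraph.mem_edgeSet _).2 (hadj q)
    · intro e he
      induction e using Sym2.ind with
      | h v w =>
        rw [SimpleGraph.mem_edgeSet] at he
        obtain ⟨x, i⟩ := v
        obtain ⟨y, l⟩ := w
        fin_cases i <;> fin_cases l
        · exact absurd he (not_hexGraph_adj_of_snd_eq_holds _ _ rfl)
        · simp only [Fin.zero_eta, Fin.mk_one] at he ⊢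
          rcases (hexGraph_adj_iff_of_snd_eq_zero_holds x y).1 he with rfl | rfl | rfl
          · exact ⟨(0, y), by simp [hedgeOf, hdvec]⟩
          · exact ⟨(1, x), by simp [hedgeOf, hdvec]⟩
          · exact ⟨(2, x), by simp [hedgeOf, hdvec]⟩
        · simp only [Fin.zero_eta, Fin.mk_one] at he ⊢
          rcases (hexGraph_adj_iff_of_snd_eq_zero_holds y x).1 he.symm with rfl | rfl | rfl
          · exact ⟨(0, x), by simp [hedgeOf, hdvec, Sym2.eq_swap]⟩
          · exact ⟨(1, y), by simp [hedgeOf, hdvec, Sym2.eq_swap]⟩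
          · exact ⟨(2, y), by simp [hedgeOf, hdvec, Sym2.eq_swap]⟩
        · exact absurd he (not_hexGraph_adj_of_snd_eq_holds _ _ rfl)
  -- rewrite the sum, for `δ > 0`, as a sum over the three cosets
  have hEq : (fun δ : ℝ => (δ : ℂ) ^ 2 * ∑ᶠ e ∈ hexGraph.edgeSet, g ((δ : ℂ) * hexMidpoint e))
      =ᶠ[𝓝[>] 0] fun δ : ℝ =>
        ∑ j : Fin 3, (δ : ℂ) ^ 2 * ∑ᶠ k : Site 2, g ((δ : ℂ) * (triEmbed k + toff j)) := by
    filter_upwards [self_mem_nhdsWithin] with δ hδ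
    have hδ : 0 < δ := hδ
    rw [← hrange, finsum_mem_range hinj, ← Finset.mul_sum]
    congr 1
    have hpt : ∀ q : Fin 3 × Site 2,
        g ((δ : ℂ) * hexMidpoint (edgeOf q)) = g ((δ : ℂ) * (triEmbed q.2 + toff q.1)) := by
      intro q; rw [hmid]
    simp_rw [hpt]
    have hfin : (Function.support fun q : Fin 3 × Site 2 =>
        g ((δ : ℂ) * (triEmbed q.2 + toff q.1))).Finite := by
      refine Set.Finite.subset (Set.finite_univ.prod
        (Set.finite_iUnion fun j : Fin 3 => finite_pt_mem hδ (toff j) hS.isBounded)) ?_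
      intro q hq
      simp only [Function.mem_support] at hq
      refine ⟨mem_univ _, mem_iUnion.2 ⟨q.1, ?_⟩⟩
      by_contra h
      exact hq (image_eq_zero_of_notMem_tsupport h)
    rw [finsum_curry _ hfin, finsum_eq_sum_of_fintype]
  refine Tendsto.congr' hEq.symm ?_
  have hlim : ((2 * Real.sqrt 3 : ℝ) : ℂ) * ∫ z, g z =
      ∑ j : Fin 3, (((triZeta.im)⁻¹ : ℝ) : ℂ) * ∫ z, g z := by
    rw [Finset.sum_const, Finset.card_univ, Fintype.card_fin, ← three_mul_inv_triZeta_im]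
    simp only [nsmul_eq_mul, Nat.cast_ofNat]
    push_cast; ring
  rw [hlim]
  exact tendsto_finsetSum _ fun j _ => tendsto_coset_sum hg hgs (toff j)

/-- **Riemann sums over the mid-edges of exhausting discrete domains.** If the vertex sets `Λ δ`
eventually contain every vertex whose scaled centre lies in a given compact subset of the open
set `U`, then for `g` continuous with compact support inside `U`,
`δ² Σ_{e ∈ Ω_δ} g(δ · mid e) → 2√3 ∫ g` as `δ → 0⁺`. -/
theorem tendsto_domain_sum {U : Set ℂ} (hU : IsOpen U) (Λ : ℝ → Finset HexVertex)
    (hexh : ∀ K : Set ℂ, IsCompact K → K ⊆ U → ∀ᶠ δ : ℝ in 𝓝[>] 0,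
      ∀ v : HexVertex, (δ : ℂ) * hexCenter v ∈ K → v ∈ Λ δ)
    {g : ℂ → ℂ} (hg : Continuous g) (hgs : HasCompactSupport g) (hgU : tsupport g ⊆ U) :
    Tendsto (fun δ : ℝ => (δ : ℂ) ^ 2 *
        ∑ᶠ e ∈ hexDomainMidEdges (Λ δ), g ((δ : ℂ) * hexMidpoint e))
      (𝓝[>] 0) (𝓝 ((2 * Real.sqrt 3 : ℝ) * ∫ z, g z)) := by
  have hS : IsCompact (tsupport g) := hgs
  obtain ⟨τ, hτ, hτU⟩ := hS.exists_cthickening_subset_open hU hgU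
  have hS' : IsCompact (cthickening τ (tsupport g)) := hS.cthickening
  have e1 := hexh _ hS' hτU
  have e2 : ∀ᶠ δ : ℝ in 𝓝[>] 0, δ < 2 * τ :=
    eventually_nhdsWithin_of_eventually_nhds (Iio_mem_nhds (by positivity))
  refine Tendsto.congr' ?_ (tendsto_edge_sum hg hgs)
  filter_upwards [self_mem_nhdsWithin, e1, e2] with δ hδ h1 h2
  have hδ : 0 < δ := hδ
  set G : Sym2 HexVertex → ℂ := fun e => g ((δ : ℂ) * hexMidpoint e) with hG
  have hset : hexGraph.edgeSet ∩ Function.support G =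
      hexDomainMidEdges (Λ δ) ∩ Function.support G := by
    ext e
    simp only [mem_inter_iff, Function.mem_support]
    constructor
    · rintro ⟨he, hne⟩
      refine ⟨?_, hne⟩
      induction e using Sym2.ind with
      | h v w =>
        have hadj : hexGraph.Adj v w := (SimpleGraph.mem_edgeSet _).1 he
        have hmid : (δ : ℂ) * hexMidpoint s(v, w) ∈ tsupport g := by
          by_contra h
          exact hne (show G s(v, w) = 0 from image_eq_zero_of_notMem_tsupport (f := g) h)
        have hv : (δ : ℂ) * hexCenter v ∈ cthickening τ (tsupport g) := by
          refine mem_cthickening_of_dist_le _ _ _ _ hmid ?_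
          rw [dist_eq_norm, ← mul_sub, norm_mul, norm_real, Real.norm_eq_abs, abs_of_pos hδ]
          have := norm_hexCenter_sub_hexMidpoint_le hadj
          nlinarith
        exact ⟨he, v, Sym2.mem_mk_left v w, h1 v hv⟩
    · rintro ⟨he, hne⟩
      exact ⟨he.1, hne⟩
  show (δ : ℂ) ^ 2 * ∑ᶠ e ∈ hexGraph.edgeSet, G e =
    (δ : ℂ) ^ 2 * ∑ᶠ e ∈ hexDomainMidEdges (Λ δ), G e
  rw [← finsum_mem_inter_support G hexGraph.edgeSet, hset, finsum_mem_inter_support]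

/-! ### Finiteness and `finsum` bookkeeping -/

/-- The neighbours of a face of `𝕋` form a finite set (there are three of them). -/
theorem neighborSet_finite (v : HexVertex) : (hexGraph.neighborSet v).Finite :=
  Set.finite_of_ncard_ne_zero (by rw [card_neighborSet_hexGraph_holds v]; norm_num)

/-- The mid-edges of a finite domain form a finite set (stated as a `Finite` instance on the
subtype; use `Set.finite_coe_iff.1` for the `Set.Finite` form). -/
theorem finite_hexDomainMidEdges (Λ : Finset HexVertex) : Finite (hexDomainMidEdges Λ) := by
  rw [Set.finite_coe_iff]
  have hsub : hexDomainMidEdges Λ ⊆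
      ⋃ v ∈ (↑Λ : Set HexVertex), (fun w => s(v, w)) '' hexGraph.neighborSet v := by
    intro e he
    obtain ⟨he, v, hv, hvΛ⟩ := he
    induction e using Sym2.ind with
    | h x y =>
      simp only [Set.mem_iUnion, Set.mem_image, SimpleGraph.mem_neighborSet, exists_prop]
      rw [SimpleGraph.mem_edgeSet] at he
      rcases Sym2.mem_iff.1 hv with rfl | rfl
      · exact ⟨v, hvΛ, y, he, rfl⟩
      · exact ⟨v, hvΛ, x, he.symm, Sym2.eq_swap⟩
  exact Set.Finite.subset (Set.Finite.biUnion (Finset.finite_toSet Λ) fun v _ =>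
    (neighborSet_finite v).image _) hsub

/-- A `finsum` over a region `{e ∈ s | p e}` of a finite set `s` is a `Finset` sum over a filter
(the region written as a conjunction, which is how `e ∈ {e | e ∈ s ∧ p e}` elaborates under the
`finsum` binder; use `simp only [Set.mem_setOf_eq]` first if needed). -/
theorem finsum_mem_eq_filter_sum {α M : Type*} [AddCommMonoid M] {s : Set α} (hs : s.Finite)
    (p : α → Prop) [DecidablePred p] (f : α → M) :
    ∑ᶠ (e) (_ : e ∈ s ∧ p e), f e = ∑ e ∈ hs.toFinset.filter p, f e := by
  have hfin : {e | e ∈ s ∧ p e}.Finite := hs.subset fun e he => he.1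
  rw [show (∑ᶠ (e) (_ : e ∈ s ∧ p e), f e) = ∑ᶠ e ∈ {e | e ∈ s ∧ p e}, f e from rfl,
    finsum_mem_eq_finite_toFinset_sum f hfin]
  refine Finset.sum_congr ?_ fun _ _ => rfl
  ext e
  simp only [Set.Finite.mem_toFinset, Set.mem_setOf_eq, Finset.mem_filter]

/-- The complexified Riemann sum of a real function is real. -/
theorem sq_mul_finsum_ofReal (δ : ℝ) (Λ : Finset HexVertex) (χ : ℂ → ℝ) :
    (δ : ℂ) ^ 2 * ∑ᶠ e ∈ hexDomainMidEdges Λ, ((χ ((δ : ℂ) * hexMidpoint e) : ℝ) : ℂ) =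
      ((δ ^ 2 * ∑ e ∈ (Set.finite_coe_iff.1 (finite_hexDomainMidEdges Λ)).toFinset, χ ((δ : ℂ) * hexMidpoint e) : ℝ) : ℂ) := by
  rw [finsum_mem_eq_finite_toFinset_sum _ (Set.finite_coe_iff.1 (finite_hexDomainMidEdges Λ))]
  push_cast
  rfl

/-! ### Counting mid-edges in compacts and balls -/

/-- **Upper count.** For a compact `K` inside the open set `U` exhausted by the domains `Λ δ`,
`δ² · #{e ∈ Ω_δ | δ·mid e ∈ K}` is eventually bounded (compare with the Riemann sum of a bump
function `≥ 1_K`). -/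
theorem eventually_count_le {U : Set ℂ} (hU : IsOpen U) (Λ : ℝ → Finset HexVertex)
    (hexh : ∀ K : Set ℂ, IsCompact K → K ⊆ U → ∀ᶠ δ : ℝ in 𝓝[>] 0,
      ∀ v : HexVertex, (δ : ℂ) * hexCenter v ∈ K → v ∈ Λ δ)
    {K : Set ℂ} (hK : IsCompact K) (hKU : K ⊆ U) :
    ∃ N : ℝ, 0 < N ∧ ∀ᶠ δ : ℝ in 𝓝[>] 0,
      δ ^ 2 * ∑ᶠ e ∈ {e | e ∈ hexDomainMidEdges (Λ δ) ∧ (δ : ℂ) * hexMidpoint e ∈ K}, (1 : ℝ)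
        ≤ N := by
  classical
  obtain ⟨χ, hχc, hχs, hχU, hχ0, hχ1, hχK⟩ := exists_bump hU hK hKU
  have hlim := tendsto_domain_sum hU Λ hexh (Complex.continuous_ofReal.comp hχc)
    (hχs.comp_left Complex.ofReal_zero)
    ((Literature.Analysis.Complex.tsupport_ofReal_comp_subset χ).trans hχU)
  set I : ℝ := ∫ z, χ z with hI
  have hI0 : 0 ≤ I := integral_nonneg hχ0
  refine ⟨2 * Real.sqrt 3 * I + 1, by positivity, ?_⟩
  have hev := (Metric.tendsto_nhds.1 hlim) 1 one_pos
  filter_upwards [hev, self_mem_nhdsWithin] with δ hδ hδpos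
  have hδpos : 0 < δ := hδpos
  simp only [Function.comp_apply] at hδ
  rw [sq_mul_finsum_ofReal, integral_complex_ofReal, ← Complex.ofReal_mul, Complex.dist_eq,
    ← Complex.ofReal_sub, Complex.norm_real, Real.norm_eq_abs] at hδ
  have h1 := (abs_lt.1 hδ).2
  set MEf := (Set.finite_coe_iff.1 (finite_hexDomainMidEdges (Λ δ))).toFinset with hMEf
  rw [finsum_mem_eq_filter_sum (Set.finite_coe_iff.1 (finite_hexDomainMidEdges (Λ δ)))]
  have hle : ∑ e ∈ MEf.filter (fun e => (δ : ℂ) * hexMidpoint e ∈ K), (1 : ℝ) ≤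
      ∑ e ∈ MEf, χ ((δ : ℂ) * hexMidpoint e) := by
    calc ∑ e ∈ MEf.filter (fun e => (δ : ℂ) * hexMidpoint e ∈ K), (1 : ℝ)
        = ∑ e ∈ MEf.filter (fun e => (δ : ℂ) * hexMidpoint e ∈ K), χ ((δ : ℂ) * hexMidpoint e) :=
          Finset.sum_congr rfl fun e he => (hχK _ (Finset.mem_filter.1 he).2).symm
      _ ≤ ∑ e ∈ MEf, χ ((δ : ℂ) * hexMidpoint e) :=
          Finset.sum_le_sum_of_subset_of_nonneg (Finset.filter_subset _ _) fun e _ _ => hχ0 _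
  have hδ2 : 0 ≤ δ ^ 2 := sq_nonneg δ
  nlinarith [mul_le_mul_of_nonneg_left hle hδ2]

/-- **Lower count.** For a closed ball of positive radius inside the open set `U` exhausted by the
domains `Λ δ`, `δ² · #{e ∈ Ω_δ | δ·mid e ∈ B}` is eventually bounded below by a positive constant
(compare with the Riemann sum of a bump function `≤ 1_B`). -/
theorem eventually_le_count {U : Set ℂ} (hU : IsOpen U) (Λ : ℝ → Finset HexVertex)
    (hexh : ∀ K : Set ℂ, IsCompact K → K ⊆ U → ∀ᶠ δ : ℝ in 𝓝[>] 0,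
      ∀ v : HexVertex, (δ : ℂ) * hexCenter v ∈ K → v ∈ Λ δ)
    {z₀ : ℂ} {r₀ : ℝ} (hr₀ : 0 < r₀) (hBU : closedBall z₀ r₀ ⊆ U) :
    ∃ α : ℝ, 0 < α ∧ ∀ᶠ δ : ℝ in 𝓝[>] 0,
      α ≤ δ ^ 2 * ∑ᶠ e ∈ {e | e ∈ hexDomainMidEdges (Λ δ) ∧
        (δ : ℂ) * hexMidpoint e ∈ closedBall z₀ r₀}, (1 : ℝ) := by
  classical
  obtain ⟨f, hf1, hf0, hfs, hf01⟩ := exists_continuous_one_zero_of_isCompact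
    (isCompact_closedBall z₀ (r₀ / 2)) (isOpen_ball (x := z₀) (ε := r₀)).isClosed_compl
    (disjoint_compl_right_iff_subset.2 (closedBall_subset_ball (by linarith)))
  have hsupp : Function.support f ⊆ ball z₀ r₀ := by
    intro z hz
    by_contra h
    exact hz (hf0 h)
  have htsupp : tsupport (f : ℂ → ℝ) ⊆ closedBall z₀ r₀ :=
    (closure_mono hsupp).trans closure_ball_subset_closedBall
  have hlim := tendsto_domain_sum hU Λ hexh (Complex.continuous_ofReal.comp f.continuous)
    (hfs.comp_left Complex.ofReal_zero)
    ((Literature.Analysis.Complex.tsupport_ofReal_comp_subset f).trans (htsupp.trans hBU))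
  set I : ℝ := ∫ z, f z with hI
  have hI : 0 < I := integral_bump_pos f.continuous hfs (fun z => (hf01 z).1)
    (hf1 (mem_closedBall_self (by positivity)))
  have h3 : 0 < Real.sqrt 3 := Real.sqrt_pos.2 (by norm_num)
  refine ⟨Real.sqrt 3 * I, by positivity, ?_⟩
  have hev := (Metric.tendsto_nhds.1 hlim) (Real.sqrt 3 * I) (by positivity)
  filter_upwards [hev, self_mem_nhdsWithin] with δ hδ hδpos
  have hδpos : 0 < δ := hδpos
  simp only [Function.comp_apply] at hδ
  rw [sq_mul_finsum_ofReal, integral_complex_ofReal, ← Complex.ofReal_mul,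
    Complex.dist_eq, ← Complex.ofReal_sub, Complex.norm_real, Real.norm_eq_abs] at hδ
  have h1 := (abs_lt.1 hδ).1
  set MEf := (Set.finite_coe_iff.1 (finite_hexDomainMidEdges (Λ δ))).toFinset with hMEf
  rw [finsum_mem_eq_filter_sum (Set.finite_coe_iff.1 (finite_hexDomainMidEdges (Λ δ)))]
  have hle : ∑ e ∈ MEf, f ((δ : ℂ) * hexMidpoint e) ≤
      ∑ e ∈ MEf.filter (fun e => (δ : ℂ) * hexMidpoint e ∈ closedBall z₀ r₀), (1 : ℝ) := by
    rw [← Finset.sum_subset (Finset.filter_subset (fun e => (δ : ℂ) * hexMidpoint e ∈ closedBall z₀ r₀) MEf)]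
    · exact Finset.sum_le_sum fun e _ => (hf01 _).2
    · intro e _ hne
      rw [Finset.mem_filter, not_and] at hne
      have hz : (δ : ℂ) * hexMidpoint e ∉ closedBall z₀ r₀ := fun h => hne (by simpa [hMEf] using ‹e ∈ MEf›) h
      by_contra hfz
      exact hz (ball_subset_closedBall (hsupp hfz))
  have hδ2 : 0 ≤ δ ^ 2 := sq_nonneg δ
  nlinarith [mul_le_mul_of_nonneg_left hle hδ2]

/-! ### The closing real inequality -/

/-- **Closing inequality of the synthesis.** With the tolerances chosen as in the main proof,
the total error `Mψ κ (ε_p + 1) η + Mψ M_H (ε_p κ Λ_b + τ) N` is at most `η₀`. -/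
theorem final_bound {Mψ κ κmax εp η Λb MH N τ η₀ : ℝ} (hMψ : 0 ≤ Mψ)
    (hκmax : κ ≤ κmax) (hκmax0 : 0 < κmax) (hεp : 0 ≤ εp) (hη : 0 ≤ η) (hΛb : 0 < Λb)
    (hMH : 0 < MH) (hN : 0 < N) (hτ : 0 ≤ τ)
    (h1 : εp ≤ η₀ / (3 * (Mψ + 1) * (κmax * (η + Λb * MH * N) + 1)))
    (h2 : η ≤ η₀ / (3 * (Mψ + 1) * κmax))
    (h3 : τ ≤ η₀ / (3 * (Mψ + 1) * MH * N)) :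
    Mψ * κ * (εp + 1) * η + Mψ * MH * (εp * κ * Λb + τ) * N ≤ η₀ := by
  have hM1 : 0 < Mψ + 1 := by linarith
  have h1' : εp * (3 * (Mψ + 1) * (κmax * (η + Λb * MH * N) + 1)) ≤ η₀ :=
    (le_div_iff₀ (by positivity)).1 h1
  have h2' : η * (3 * (Mψ + 1) * κmax) ≤ η₀ := (le_div_iff₀ (by positivity)).1 h2
  have h3' : τ * (3 * (Mψ + 1) * MH * N) ≤ η₀ := (le_div_iff₀ (by positivity)).1 h3
  -- replace `κ` by `κmax` and `Mψ` by `Mψ + 1`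
  have step1 : Mψ * κ * (εp + 1) * η + Mψ * MH * (εp * κ * Λb + τ) * N ≤
      (Mψ + 1) * (εp * (κmax * (η + Λb * MH * N)) + κmax * η + MH * N * τ) := by
    have e1 : Mψ * κ * (εp + 1) * η + Mψ * MH * (εp * κ * Λb + τ) * N =
        Mψ * (εp * (κ * (η + Λb * MH * N)) + κ * η + MH * N * τ) := by ring
    rw [e1]
    have hk : εp * (κ * (η + Λb * MH * N)) + κ * η + MH * N * τ ≤
        εp * (κmax * (η + Λb * MH * N)) + κmax * η + MH * N * τ := by
      have : 0 ≤ η + Λb * MH * N := by positivity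
      nlinarith [mul_le_mul_of_nonneg_left hκmax this, mul_le_mul_of_nonneg_right hκmax hη]
    have hpos : 0 ≤ εp * (κmax * (η + Λb * MH * N)) + κmax * η + MH * N * τ := by positivity
    nlinarith
  have t1 : (Mψ + 1) * (εp * (κmax * (η + Λb * MH * N))) ≤ η₀ / 3 := by
    have : εp * (κmax * (η + Λb * MH * N)) ≤ εp * (κmax * (η + Λb * MH * N) + 1) := by
      nlinarith
    nlinarith
  have t2 : (Mψ + 1) * (κmax * η) ≤ η₀ / 3 := by nlinarith
  have t3 : (Mψ + 1) * (MH * N * τ) ≤ η₀ / 3 := by nlinarith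
  nlinarith

end Summit.CriticalPhenomena.SAWScalingLimit.Theorems.RetrievalSynthesisR
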